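import Literature.Barriers.CriticalPhenomena.WeaklySAWCouplingFlowProduct
import Literature.Barriers.CriticalPhenomena.WeaklySAWCouplingFlowRemainder
import HarnessLib

/-!
# The product formula for the perturbed flow:
# `∏_{k<n}(1 - γβ_kǧ_k)⁻¹ = (g₀/ǧ_n)^γ (c + o(1))`, `c = 1 + O(g₀)`, WITH the remainder `r_j`
# (Bauerschmidt–Brydges–Slade 2015, §8.3, the display before the third lemma)

Continuation (theorems, plus the real definitions `stepFactorR`, `prodFactorR`, `prodFactorRLim`)
of `WeaklySAWCouplingFlowProduct.lean` — which proves the product formula for the UNPERTURBED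
recursion `ḡ_{j+1} = ḡ_j - β_jḡ_j²` — and of `WeaklySAWCouplingFlowRemainder.lean` (the perturbed
recursion `ǧ_{j+1} = ǧ_j - β_jǧ_j² + r_j`, `|r_j| ≤ ρ_jǧ_j²`, hypotheses `GchHyp`).

In §8.3 of R. Bauerschmidt, D. C. Brydges, G. Slade, CMP 337 (2015), arXiv:1403.7422, the proof of
the third lemma (`μ̌_j' = L^{2j}(ǧ_j/g₀)^γ(c + O(χ_jǧ_j))`, the origin of the exponent `γ = 1/4` of
Theorem 1.1) rests on the product formula stated before it for the PERTURBED flow `ǧ`: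
"`∏_{k=j}^l (1 - γβ_kǧ_k)⁻¹ = (ǧ_j/ǧ_{l+1})^γ (c_j + O(χ_lḡ_l))`, with `c_j = 1 + O(χ_jḡ_j)` …
The product formula is a consequence of the recursion relation [`ǧ_{j+1} = ǧ_j - β_jǧ_j² + r_j`];
its proof is identical to that of [BBS-rg-flow, Lemma 2.1(iii)(a)] where the same statement is
proved with `r_j = 0`." This file carries out that proof with `r_j ≠ 0`, for `j = 0` (the case
used in §8.3 and §8.5), every `γ ∈ [0, 1]`, and explicit constants:

* the one-step identity behind "Taylor's theorem" with remainder: since `ǧ_{k+1}/ǧ_k = 1 - t_k + s_k`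
  (`t_k = β_kǧ_k`, `s_k = r_k/ǧ_k`), `(1 - γt_k)⁻¹ = (ǧ_k/ǧ_{k+1})^γ F_γ(t_k, s_k)` with
  `F_γ(t,s) = (1 - t + s)^γ/(1 - γt) = f_γ(t)(1 + s/(1-t))^γ` (`stepFactorR`, `stepFactorR_eq`), and
  `1 - (16/9)γt² - (4/3)|s| ≤ F_γ(t,s) ≤ 1 + (4/3)|s|` on `t ∈ [0,1/4]`, `|s| ≤ 1/4` (Bernoulli's
  inequality for real exponents; `one_sub_le_stepFactorR`, `stepFactorR_le`);
* the exact identity `∏_{k<n}(1 - γβ_kǧ_k)⁻¹ = (g₀/ǧ_n)^γ P_n`, `P_n = ∏_{k<n} F_γ(t_k,s_k)`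
  (`GchHyp.prod_inv_one_sub_eq`);
* the budget: `Σ_{k<n} t_k² ≤ Bg₀(1 + 2Q_n)`, `Σ_{k<n}|s_k| ≤ Q_n`, `Q_n = Σ_{k<n} ρ_kǧ_k`
  (in the source `Q = RΣ_kχ_kǧ_k² = O(g₀)`), whence
  `1 - (16/9)γBg₀(1 + 2Q_n) - (4/3)Q_n ≤ P_n ≤ exp((4/3)Q_n)` (`GchHyp.one_sub_le_prodFactorR`,
  `GchHyp.prodFactorR_le_exp`): "`c_j = 1 + O(χ_jḡ_j)`";
* for summable `ρ` (the massive case): `P_n → c = exp(Σ_k log F_k) > 0`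
  (`GchHyp.tendsto_prodFactorR`), the same two-sided bounds for `c`, and the tail estimate
  `P_n e^{-T_n} ≤ c ≤ P_n e^{T_n}`, `T_n = Σ_{k≥n}((32/9)γt_k² + 4|s_k|) → 0`
  (`GchHyp.prodFactorRLim_mem_mul_exp`): "`c_{j,l} = c_j + O(χ_lḡ_l)`";
* the printed shape (`GchHyp.prod_inv_one_sub_mem`):
  `(g₀/ǧ_n)^γ c e^{-T_n} ≤ ∏_{k<n}(1 - γβ_kǧ_k)⁻¹ ≤ (g₀/ǧ_n)^γ c e^{T_n}`.

Not here: general `j` (products starting at `j > 0` are quotients of these), the `χ`-weighted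
form of the error terms, and the continuity of `c` in `(m², g₀)`.

## References
* R. Bauerschmidt, D. C. Brydges, G. Slade, CMP 337 (2015), §8.3 (the product formula before the
  third lemma, and `Π_j` in its proof). [BauerschmidtBrydgesSlade2015LogCorr]
* R. Bauerschmidt, D. C. Brydges, G. Slade, Ann. Henri Poincaré 16 (2015), Lemma 2.1(iii)(a) and
  its proof. [BauerschmidtBrydgesSlade2015Flow]
-/

noncomputable section

open Filter Topology Finset
open scoped BigOperators

namespace Literature.Barriers.CriticalPhenomena

namespace CTWSAW

/-! ### The two-variable step factor `F_γ(t,s) = (1 - t + s)^γ/(1 - γt)` -/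

open Real in
/-- The per-step factor with remainder: `F_γ(t,s) = (1 - t + s)^γ/(1 - γt)`, so that
`(1 - γt_k)⁻¹ = (ǧ_k/ǧ_{k+1})^γ F_γ(t_k,s_k)` when `ǧ_{k+1}/ǧ_k = 1 - t_k + s_k`
(`t_k = β_kǧ_k`, `s_k = r_k/ǧ_k`); `F_γ(t,0) = f_γ(t)` is `stepFactor` of the unperturbed file.
[cite: BauerschmidtBrydgesSlade2015Flow, Lemma 2.1 (proof of (iii-a): (1 - γβ_kḡ_k)⁻¹ = (ḡ_k/ḡ_{k+1})^γ(1 + r_k))]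
[cite: BauerschmidtBrydgesSlade2015LogCorr, §8.3 (product formula for ǧ, "proof identical … with r_j = 0")] -/
def stepFactorR (γ t s : ℝ) : ℝ := (1 - t + s) ^ γ / (1 - γ * t)

/-- `F_γ(t,0) = f_γ(t)`. [cite: BauerschmidtBrydgesSlade2015Flow, Lemma 2.1 (proof of (iii-a))] -/
@[simp] theorem stepFactorR_zero_right (γ t : ℝ) : stepFactorR γ t 0 = stepFactor γ t := by
  simp [stepFactorR, stepFactor]

/-- The factorisation `F_γ(t,s) = f_γ(t)(1 + s/(1-t))^γ` (`t < 1`, `1 - t + s ≥ 0`).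
[cite: BauerschmidtBrydgesSlade2015Flow, Lemma 2.1 (proof of (iii-a), Taylor's theorem)] -/
theorem stepFactorR_eq (γ : ℝ) {t s : ℝ} (ht : t < 1) (hs : 0 ≤ 1 - t + s) :
    stepFactorR γ t s = stepFactor γ t * (1 + s / (1 - t)) ^ γ := by
  unfold stepFactorR stepFactor
  have h1t : 0 < 1 - t := by linarith
  have e : 1 - t + s = (1 - t) * (1 + s / (1 - t)) := by field_simp
  have hu : 0 ≤ 1 + s / (1 - t) := by
    have : 1 + s / (1 - t) = (1 - t + s) / (1 - t) := by field_simp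
    rw [this]; exact div_nonneg hs h1t.le
  rw [e, Real.mul_rpow h1t.le hu]
  ring

/-- `F_γ(t,s) > 0` for `t ∈ [0,1/4]`, `|s| ≤ 1/4`, `γ ≤ 1`. [folklore] -/
theorem stepFactorR_pos {γ t s : ℝ} (ht0 : 0 ≤ t) (ht : t ≤ 1 / 4) (hs : |s| ≤ 1 / 4)
    (hγ1 : γ ≤ 1) : 0 < stepFactorR γ t s := by
  unfold stepFactorR
  have h1 : 0 < 1 - t + s := by linarith [neg_abs_le s]
  have h2 : 0 < 1 - γ * t := by nlinarith [mul_le_mul_of_nonneg_right hγ1 ht0]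
  exact div_pos (Real.rpow_pos_of_pos h1 _) h2

/-- **Upper bound**: `F_γ(t,s) ≤ 1 + (4/3)|s|` for `t ∈ [0,1/4]`, `|s| ≤ 1/4`, `γ ∈ [0,1]`
(`f_γ ≤ 1` and Bernoulli: `(1 + u)^γ ≤ 1 + γu`, `u = s/(1-t)`, `|u| ≤ (4/3)|s|`).
[cite: BauerschmidtBrydgesSlade2015Flow, Lemma 2.1 (proof of (iii-a): r_k = O(β_kḡ_k)², here with the remainder)] -/
theorem stepFactorR_le {γ t s : ℝ} (ht0 : 0 ≤ t) (ht : t ≤ 1 / 4) (hs : |s| ≤ 1 / 4)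
    (hγ0 : 0 ≤ γ) (hγ1 : γ ≤ 1) : stepFactorR γ t s ≤ 1 + 4 / 3 * |s| := by
  have h1t : 0 < 1 - t := by linarith
  have hpos : 0 ≤ 1 - t + s := by linarith [neg_abs_le s]
  rw [stepFactorR_eq γ (by linarith) hpos]
  set u := s / (1 - t) with hu
  have hu1 : -1 ≤ u := by
    rw [hu, le_div_iff₀ h1t]; linarith [neg_abs_le s]
  have huabs : |u| ≤ 4 / 3 * |s| := by
    rw [hu, abs_div, abs_of_pos h1t, div_le_iff₀ h1t]
    nlinarith [abs_nonneg s]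
  have hB : (1 + u) ^ γ ≤ 1 + γ * u := rpow_one_add_le_one_add_mul_self hu1 hγ0 hγ1
  have hB' : (1 + u) ^ γ ≤ 1 + |u| := by
    refine hB.trans ?_
    have : γ * u ≤ 1 * |u| := by
      rcases le_or_gt 0 u with h0 | h0
      · rw [abs_of_nonneg h0]; nlinarith
      · rw [abs_of_neg h0]; nlinarith
    linarith
  have hf1 : stepFactor γ t ≤ 1 := stepFactor_le_one ht0 (by linarith) hγ0 hγ1
  have hf0 : 0 ≤ stepFactor γ t := (stepFactor_pos (by linarith) (by nlinarith)).le
  have hr0 : 0 ≤ (1 + u) ^ γ := Real.rpow_nonneg (by linarith) _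
  calc stepFactor γ t * (1 + u) ^ γ ≤ 1 * (1 + u) ^ γ := mul_le_mul_of_nonneg_right hf1 hr0
    _ ≤ 1 + |u| := by rw [one_mul]; exact hB'
    _ ≤ 1 + 4 / 3 * |s| := by linarith

/-- **Lower bound**: `1 - (16/9)γt² - (4/3)|s| ≤ F_γ(t,s)` for `t ∈ [0,1/4]`, `|s| ≤ 1/4`,
`γ ∈ [0,1]` (`f_γ(t) ≥ 1 - (16/9)γt²` and `(1 + u)^γ ≥ 1 - |u|` for `γ ≤ 1`).
[cite: BauerschmidtBrydgesSlade2015Flow, Lemma 2.1 (proof of (iii-a): log(1 + r_k) = O(χ_kḡ_k²), here with the remainder)] -/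
theorem one_sub_le_stepFactorR {γ t s : ℝ} (ht0 : 0 ≤ t) (ht : t ≤ 1 / 4) (hs : |s| ≤ 1 / 4)
    (hγ0 : 0 ≤ γ) (hγ1 : γ ≤ 1) :
    1 - 16 / 9 * γ * t ^ 2 - 4 / 3 * |s| ≤ stepFactorR γ t s := by
  have h1t : 0 < 1 - t := by linarith
  have hpos : 0 ≤ 1 - t + s := by linarith [neg_abs_le s]
  rw [stepFactorR_eq γ (by linarith) hpos]
  set u := s / (1 - t) with hu
  have huabs : |u| ≤ 4 / 3 * |s| := by
    rw [hu, abs_div, abs_of_pos h1t, div_le_iff₀ h1t]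
    nlinarith [abs_nonneg s]
  have hu3 : |u| ≤ 1 / 3 := by linarith
  -- (1 + u)^γ ≥ 1 - |u|
  have hlow : 1 - |u| ≤ (1 + u) ^ γ := by
    rcases le_or_gt 0 u with h0 | h0
    · rw [abs_of_nonneg h0]
      have : 1 ≤ (1 + u) ^ γ := Real.one_le_rpow (by linarith) hγ0
      linarith
    · rw [abs_of_neg h0]
      have h1 : (1 + u) ^ (1 : ℝ) ≤ (1 + u) ^ γ :=
        Real.rpow_le_rpow_of_exponent_ge (by linarith [neg_abs_le u, abs_of_neg h0])
          (by linarith) hγ1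
      rw [Real.rpow_one] at h1
      linarith
  have hf : 1 - 16 / 9 * γ * t ^ 2 ≤ stepFactor γ t := one_sub_le_stepFactor ht0 ht hγ0 hγ1
  have ha0 : 0 ≤ 16 / 9 * γ * t ^ 2 := by positivity
  have ha1 : 16 / 9 * γ * t ^ 2 ≤ 1 / 9 := by nlinarith
  have hf0 : 0 ≤ 1 - 16 / 9 * γ * t ^ 2 := by linarith
  have hr0 : 0 ≤ 1 - |u| := by linarith
  calc 1 - 16 / 9 * γ * t ^ 2 - 4 / 3 * |s| ≤ 1 - 16 / 9 * γ * t ^ 2 - |u| := by linarith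
    _ ≤ (1 - 16 / 9 * γ * t ^ 2) * (1 - |u|) := by nlinarith [abs_nonneg u]
    _ ≤ stepFactor γ t * (1 + u) ^ γ := mul_le_mul hf hlow hr0 (hf0.trans hf)

/-! ### The correction product `P_n` of the perturbed flow -/

/-- The correction product `P_n = ∏_{k<n} F_γ(β_kǧ_k, r_k/ǧ_k)` of a perturbed flow `ǧ = g`
(= `c_{0,n-1} = ∏_{k<n}(1 + r_k)` of the flow paper, with remainder).
[cite: BauerschmidtBrydgesSlade2015Flow, Lemma 2.1 (proof of (iii-a), c_{j,l})]
[cite: BauerschmidtBrydgesSlade2015LogCorr, §8.3 (product formula for ǧ)] -/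
def prodFactorR (β g : ℕ → ℝ) (γ : ℝ) (n : ℕ) : ℝ :=
  ∏ k ∈ range n, stepFactorR γ (β k * g k) (flowRem β g k / g k)

/-- Its limit `c = lim_n P_n`, realised as `exp(Σ_k log F_k)` (the factors are positive and
`Σ_k|log F_k| < ∞` in the massive case, `GchHyp.tendsto_prodFactorR`).
[cite: BauerschmidtBrydgesSlade2015Flow, Lemma 2.1(iii)(a) (c_j = exp(Σ_k log(1 + r_k)))] -/
def prodFactorRLim (β g : ℕ → ℝ) (γ : ℝ) : ℝ :=
  Real.exp (∑' k, Real.log (stepFactorR γ (β k * g k) (flowRem β g k / g k)))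

namespace GchHyp

variable {β ρ g : ℕ → ℝ} {B g₀ γ : ℝ} (h : GchHyp β ρ g B g₀)
include h

/-- `ǧ_{k+1}/ǧ_k = 1 - t_k + s_k` with `t_k = β_kǧ_k`, `s_k = r_k/ǧ_k`.
[cite: BauerschmidtBrydgesSlade2015LogCorr, §8.3 (the recursion for ǧ with remainder)] -/
theorem ratio_eq (k : ℕ) : g (k + 1) / g k = 1 - β k * g k + flowRem β g k / g k := by
  have hgk := (h.g_pos k).ne'
  rw [flowRem_spec β g k]
  field_simp

/-- `|s_k| = |r_k|/ǧ_k ≤ ρ_kǧ_k ≤ 1/4`. [cite: BauerschmidtBrydgesSlade2015LogCorr, §8.3 (r_j = O(χ_jǧ_j³))] -/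
theorem abs_s_le (k : ℕ) : |flowRem β g k / g k| ≤ ρ k * g k := by
  have hgk := h.g_pos k
  rw [abs_div, abs_of_pos hgk, div_le_iff₀ hgk]
  calc |flowRem β g k| ≤ ρ k * g k ^ 2 := h.rem_le k
    _ = ρ k * g k * g k := by ring

/-- `|s_k| ≤ 1/4`. [folklore] -/
theorem abs_s_le_quarter (k : ℕ) : |flowRem β g k / g k| ≤ 1 / 4 :=
  (h.abs_s_le k).trans <| by
    calc ρ k * g k ≤ 1 / 4 * 1 :=
          mul_le_mul (h.rho_le k) (h.g_le_one k) (h.g_pos k).le (by norm_num)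
      _ = 1 / 4 := by norm_num

/-- `F_k > 0`. [folklore] -/
theorem stepFactorR_pos' (hγ1 : γ ≤ 1) (k : ℕ) :
    0 < stepFactorR γ (β k * g k) (flowRem β g k / g k) :=
  stepFactorR_pos (h.beta_mul_mem k).1 (h.beta_mul_mem k).2 (h.abs_s_le_quarter k) hγ1

/-- `P_n > 0`. [folklore] -/
theorem prodFactorR_pos (hγ1 : γ ≤ 1) (n : ℕ) : 0 < prodFactorR β g γ n :=
  prod_pos fun k _ => h.stepFactorR_pos' hγ1 k

/-- **The product formula, exact form, with remainder** (`j = 0`):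
`∏_{k<n}(1 - γβ_kǧ_k)⁻¹ = (g₀/ǧ_n)^γ P_n`.
[cite: BauerschmidtBrydgesSlade2015LogCorr, §8.3 (∏_{k=j}^l(1 - γβ_kǧ_k)⁻¹ = (ǧ_j/ǧ_{l+1})^γ(c_j + O(χ_lḡ_l)))]
[cite: BauerschmidtBrydgesSlade2015Flow, Lemma 2.1(iii)(a)] -/
theorem prod_inv_one_sub_eq (hγ1 : γ ≤ 1) (n : ℕ) :
    ∏ k ∈ range n, (1 - γ * (β k * g k))⁻¹ = (g₀ / g n) ^ γ * prodFactorR β g γ n := by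
  induction n with
  | zero => simp [prodFactorR, h.init, div_self h.pos₀.ne']
  | succ n ih =>
    rw [prod_range_succ, ih]
    unfold prodFactorR
    rw [prod_range_succ]
    have hgn := h.g_pos n
    have hgn1 := h.g_pos (n + 1)
    obtain ⟨ht0, ht1⟩ := h.beta_mul_mem n
    have hγt : γ * (β n * g n) < 1 := by nlinarith
    -- (g₀/ǧ_n)^γ = (g₀/ǧ_{n+1})^γ (ǧ_{n+1}/ǧ_n)^γ and ǧ_{n+1}/ǧ_n = 1 - t + s
    have key : (g₀ / g n) ^ γ = (g₀ / g (n + 1)) ^ γ *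
        (1 - β n * g n + flowRem β g n / g n) ^ γ := by
      rw [← h.ratio_eq n, ← Real.mul_rpow (div_pos h.pos₀ hgn1).le (div_pos hgn1 hgn).le]
      congr 1
      field_simp
    rw [key]
    unfold stepFactorR
    rw [div_eq_mul_inv _ (1 - γ * (β n * g n))]
    ring

/-! ### The budget: `Σ t_k²` and `Σ|s_k|` in terms of `Q_n = Σ_{k<n} ρ_kǧ_k` -/

/-- `Σ_{k<n} β_kǧ_k² = g₀ - ǧ_n + Σ_{k<n} r_k` (telescoping the recursion).
[cite: BauerschmidtBrydgesSlade2015LogCorr, §8.3 (the recursion for ǧ with remainder)] -/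
theorem sum_beta_mul_sq_eq (n : ℕ) :
    ∑ k ∈ range n, β k * g k ^ 2 = g₀ - g n + ∑ k ∈ range n, flowRem β g k := by
  induction n with
  | zero => simp [h.init]
  | succ n ih =>
    rw [sum_range_succ, sum_range_succ, ih, flowRem_spec β g n]
    ring

/-- `Σ_{k<n} t_k² ≤ Bg₀(1 + 2Q_n)`, `Q_n = Σ_{k<n} ρ_kǧ_k` (`t_k² ≤ Bβ_kǧ_k²`, the telescoping
identity, `|r_k| ≤ ρ_kǧ_k² ≤ 2g₀ρ_kǧ_k`).
[cite: BauerschmidtBrydgesSlade2015Flow, Lemma 2.1 (proof of (iii-a): Σ_k(β_kḡ_k)² = O(χ_jḡ_j))] -/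
theorem sum_t_sq_le (n : ℕ) :
    ∑ k ∈ range n, (β k * g k) ^ 2 ≤ B * g₀ * (1 + 2 * ∑ k ∈ range n, ρ k * g k) := by
  have hB := h.B_nonneg
  have h1 : ∑ k ∈ range n, (β k * g k) ^ 2 ≤ B * ∑ k ∈ range n, β k * g k ^ 2 := by
    rw [mul_sum]
    refine sum_le_sum fun k _ => ?_
    have hb := h.beta_nonneg k
    have := h.beta_le k
    have : (β k * g k) ^ 2 = β k * (β k * g k ^ 2) := by ring
    rw [this]
    exact mul_le_mul_of_nonneg_right (h.beta_le k) (mul_nonneg hb (sq_nonneg _))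
  have h2 : ∑ k ∈ range n, β k * g k ^ 2 ≤ g₀ + 2 * g₀ * ∑ k ∈ range n, ρ k * g k := by
    rw [h.sum_beta_mul_sq_eq n, mul_sum]
    have hgn := (h.g_pos n).le
    have h3 : ∑ k ∈ range n, flowRem β g k ≤ ∑ k ∈ range n, 2 * g₀ * (ρ k * g k) := by
      refine sum_le_sum fun k _ => ?_
      calc flowRem β g k ≤ |flowRem β g k| := le_abs_self _
        _ ≤ ρ k * g k ^ 2 := h.rem_le k
        _ = (ρ k * g k) * g k := by ring
        _ ≤ (ρ k * g k) * (2 * g₀) :=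
            mul_le_mul_of_nonneg_left (h.le_two_mul k) (mul_nonneg (h.rho_nonneg k) (h.g_pos k).le)
        _ = 2 * g₀ * (ρ k * g k) := by ring
    linarith
  calc ∑ k ∈ range n, (β k * g k) ^ 2 ≤ B * ∑ k ∈ range n, β k * g k ^ 2 := h1
    _ ≤ B * (g₀ + 2 * g₀ * ∑ k ∈ range n, ρ k * g k) := mul_le_mul_of_nonneg_left h2 hB
    _ = B * g₀ * (1 + 2 * ∑ k ∈ range n, ρ k * g k) := by ring

/-- `Σ_{k<n}|s_k| ≤ Q_n`. [cite: BauerschmidtBrydgesSlade2015LogCorr, §8.3 (r_j = O(χ_jǧ_j³))] -/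
theorem sum_abs_s_le (n : ℕ) :
    ∑ k ∈ range n, |flowRem β g k / g k| ≤ ∑ k ∈ range n, ρ k * g k :=
  sum_le_sum fun k _ => h.abs_s_le k

/-- `Q_n = Σ_{k<n} ρ_kǧ_k ≥ 0`. [folklore] -/
theorem Q_nonneg (n : ℕ) : 0 ≤ ∑ k ∈ range n, ρ k * g k :=
  sum_nonneg fun k _ => mul_nonneg (h.rho_nonneg k) (h.g_pos k).le

/-! ### Two-sided bounds on `P_n`: "`c_j = 1 + O(χ_jḡ_j)`" -/

/-- **Lower bound**: `1 - (16/9)γBg₀(1 + 2Q_n) - (4/3)Q_n ≤ P_n` (termwise lower bounds,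
then Weierstrass' product inequality).
[cite: BauerschmidtBrydgesSlade2015Flow, Lemma 2.1(iii)(a) (c_j = 1 + O(χ_jḡ_j))]
[cite: BauerschmidtBrydgesSlade2015LogCorr, §8.3 (c_j = 1 + O(χ_jḡ_j) in the product formula)] -/
theorem one_sub_le_prodFactorR (hγ0 : 0 ≤ γ) (hγ1 : γ ≤ 1) (n : ℕ) :
    1 - 16 / 9 * γ * (B * g₀ * (1 + 2 * ∑ k ∈ range n, ρ k * g k))
      - 4 / 3 * ∑ k ∈ range n, ρ k * g k ≤ prodFactorR β g γ n := by
  -- a_k = (16/9)γt_k² + (4/3)|s_k| ∈ [0, 1]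
  set a : ℕ → ℝ := fun k => 16 / 9 * γ * (β k * g k) ^ 2 + 4 / 3 * |flowRem β g k / g k| with ha
  have ha0 : ∀ k, 0 ≤ a k := fun k => by rw [ha]; positivity
  have ha1 : ∀ k, a k ≤ 1 := fun k => by
    obtain ⟨ht0, ht1⟩ := h.beta_mul_mem k
    have hs := h.abs_s_le_quarter k
    have : 16 / 9 * γ * (β k * g k) ^ 2 ≤ 1 / 9 := by nlinarith
    rw [ha]; dsimp only; linarith
  have hstep : ∀ k, 1 - a k ≤ stepFactorR γ (β k * g k) (flowRem β g k / g k) := fun k => by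
    obtain ⟨ht0, ht1⟩ := h.beta_mul_mem k
    have := one_sub_le_stepFactorR ht0 ht1 (h.abs_s_le_quarter k) hγ0 hγ1
    rw [ha]; dsimp only; linarith
  -- ∏ F_k ≥ ∏ (1 - a_k) ≥ 1 - Σ a_k
  have hW := one_sub_sum_range_le_prod (fun k => 1 - a k) n (fun k _ => by linarith [ha1 k])
    (fun k _ => by linarith [ha0 k])
  have hP : ∏ k ∈ range n, (1 - a k) ≤ prodFactorR β g γ n :=
    prod_le_prod (fun k _ => by linarith [ha1 k]) fun k _ => hstep k
  have hsum : ∑ k ∈ range n, (1 - (1 - a k)) =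
      16 / 9 * γ * ∑ k ∈ range n, (β k * g k) ^ 2 + 4 / 3 * ∑ k ∈ range n, |flowRem β g k / g k| := by
    simp only [sub_sub_cancel, ha, sum_add_distrib, mul_sum]
  rw [hsum] at hW
  have h1 := h.sum_t_sq_le n
  have h2 := h.sum_abs_s_le n
  have h3 : 16 / 9 * γ * ∑ k ∈ range n, (β k * g k) ^ 2 ≤
      16 / 9 * γ * (B * g₀ * (1 + 2 * ∑ k ∈ range n, ρ k * g k)) :=
    mul_le_mul_of_nonneg_left h1 (by positivity)
  linarith

/-- **Upper bound**: `P_n ≤ exp((4/3)Q_n)` (`F_k ≤ 1 + (4/3)|s_k| ≤ exp((4/3)|s_k|)`).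
[cite: BauerschmidtBrydgesSlade2015Flow, Lemma 2.1(iii)(a) (c_j = 1 + O(χ_jḡ_j))] -/
theorem prodFactorR_le_exp (hγ0 : 0 ≤ γ) (hγ1 : γ ≤ 1) (n : ℕ) :
    prodFactorR β g γ n ≤ Real.exp (4 / 3 * ∑ k ∈ range n, ρ k * g k) := by
  have hstep : ∀ k, stepFactorR γ (β k * g k) (flowRem β g k / g k) ≤
      Real.exp (4 / 3 * (ρ k * g k)) := fun k => by
    obtain ⟨ht0, ht1⟩ := h.beta_mul_mem k
    calc stepFactorR γ (β k * g k) (flowRem β g k / g k) ≤ 1 + 4 / 3 * |flowRem β g k / g k| :=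
          stepFactorR_le ht0 ht1 (h.abs_s_le_quarter k) hγ0 hγ1
      _ ≤ 1 + 4 / 3 * (ρ k * g k) := by linarith [h.abs_s_le k]
      _ ≤ Real.exp (4 / 3 * (ρ k * g k)) := by
          linarith [Real.add_one_le_exp (4 / 3 * (ρ k * g k))]
  calc prodFactorR β g γ n ≤ ∏ k ∈ range n, Real.exp (4 / 3 * (ρ k * g k)) :=
        prod_le_prod (fun k _ => (h.stepFactorR_pos' hγ1 k).le) fun k _ => hstep k
    _ = Real.exp (4 / 3 * ∑ k ∈ range n, ρ k * g k) := by rw [mul_sum, Real.exp_sum]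

/-! ### The limit `c = lim P_n` (massive case) and the tail estimate "`c_{j,l} = c_j + O(χ_lḡ_l)`" -/

/-- The summable majorant `w_k = (32/9)γt_k² + 4|s_k|` of `|log F_k|`. [folklore] -/
theorem abs_log_stepFactorR_le (hγ0 : 0 ≤ γ) (hγ1 : γ ≤ 1) (k : ℕ) :
    |Real.log (stepFactorR γ (β k * g k) (flowRem β g k / g k))| ≤
      32 / 9 * γ * (β k * g k) ^ 2 + 4 * |flowRem β g k / g k| := by
  obtain ⟨ht0, ht1⟩ := h.beta_mul_mem k
  have hs := h.abs_s_le_quarter k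
  set F := stepFactorR γ (β k * g k) (flowRem β g k / g k) with hF
  set a := 16 / 9 * γ * (β k * g k) ^ 2 + 4 / 3 * |flowRem β g k / g k| with ha
  set b := 4 / 3 * |flowRem β g k / g k| with hb
  have hFpos : 0 < F := h.stepFactorR_pos' hγ1 k
  have hlo : 1 - a ≤ F := by
    have := one_sub_le_stepFactorR ht0 ht1 hs hγ0 hγ1; rw [ha]; linarith
  have hup : F ≤ 1 + b := stepFactorR_le ht0 ht1 hs hγ0 hγ1
  have ha0 : 0 ≤ a := by rw [ha]; positivity
  have ha1 : a ≤ 1 / 2 := by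
    have : 16 / 9 * γ * (β k * g k) ^ 2 ≤ 1 / 9 := by nlinarith
    rw [ha]; linarith
  -- log F ≤ F - 1 ≤ b and log F ≥ 1 - 1/F ≥ 1 - 1/(1 - a) ≥ -2a
  have h1 : Real.log F ≤ b := by linarith [Real.log_le_sub_one_of_pos hFpos]
  have h2 : -(2 * a) ≤ Real.log F := by
    have h3 := Real.one_sub_inv_le_log_of_pos hFpos
    have h4 : F⁻¹ ≤ (1 - a)⁻¹ := inv_anti₀ (by linarith) hlo
    have h5 : (1 - a)⁻¹ ≤ 1 + 2 * a := by
      rw [inv_le_iff_one_le_mul₀ (by linarith)]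
      nlinarith
    linarith
  rw [abs_le]
  constructor
  · rw [ha] at h2; linarith [abs_nonneg (flowRem β g k / g k)]
  · rw [hb] at h1
    have : 0 ≤ 32 / 9 * γ * (β k * g k) ^ 2 := by positivity
    linarith

/-- `t_k²` is summable when `ρ` is (bounded partial sums, `sum_t_sq_le`).
[cite: BauerschmidtBrydgesSlade2015Flow, Lemma 2.1 (proof of (iii-a))] -/
theorem summable_t_sq (hρ : Summable ρ) : Summable fun k => (β k * g k) ^ 2 := by
  have hQ : ∀ n, ∑ k ∈ range n, ρ k * g k ≤ ∑' k, ρ k := fun n =>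
    (sum_le_sum fun k _ => by
      calc ρ k * g k ≤ ρ k * 1 := mul_le_mul_of_nonneg_left (h.g_le_one k) (h.rho_nonneg k)
        _ = ρ k := mul_one _).trans (hρ.sum_le_tsum (range n) fun k _ => h.rho_nonneg k)
  refine summable_of_sum_range_le (fun k => sq_nonneg _) (c := B * g₀ * (1 + 2 * ∑' k, ρ k)) ?_
  intro n
  refine (h.sum_t_sq_le n).trans ?_
  have hBg : 0 ≤ B * g₀ := mul_nonneg h.B_nonneg h.pos₀.le
  exact mul_le_mul_of_nonneg_left (by linarith [hQ n]) hBg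

/-- `|s_k|` is summable when `ρ` is. [folklore] -/
theorem summable_abs_s (hρ : Summable ρ) : Summable fun k => |flowRem β g k / g k| :=
  Summable.of_nonneg_of_le (fun k => abs_nonneg _)
    (fun k => (h.abs_s_le k).trans <| by
      calc ρ k * g k ≤ ρ k * 1 := mul_le_mul_of_nonneg_left (h.g_le_one k) (h.rho_nonneg k)
        _ = ρ k := mul_one _) hρ

/-- The majorant `w` is summable when `ρ` is. [folklore] -/
theorem summable_majorant (hρ : Summable ρ) :
    Summable fun k => 32 / 9 * γ * (β k * g k) ^ 2 + 4 * |flowRem β g k / g k| :=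
  ((h.summable_t_sq hρ).mul_left _).add ((h.summable_abs_s hρ).mul_left _)

/-- **`Σ_k|log F_k| < ∞`** in the massive case. [cite: BauerschmidtBrydgesSlade2015Flow, Lemma 2.1(iii)(a) (Σ_k log(1 + r_k) converges)] -/
theorem summable_log_stepFactorR (hγ0 : 0 ≤ γ) (hγ1 : γ ≤ 1) (hρ : Summable ρ) :
    Summable fun k => Real.log (stepFactorR γ (β k * g k) (flowRem β g k / g k)) :=
  Summable.of_norm_bounded (h.summable_majorant hρ) fun k => by
    rw [Real.norm_eq_abs]; exact h.abs_log_stepFactorR_le hγ0 hγ1 k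

/-- `P_n = exp(Σ_{k<n} log F_k)`. [folklore] -/
theorem prodFactorR_eq_exp_sum (hγ1 : γ ≤ 1) (n : ℕ) :
    prodFactorR β g γ n =
      Real.exp (∑ k ∈ range n, Real.log (stepFactorR γ (β k * g k) (flowRem β g k / g k))) := by
  rw [Real.exp_sum, prodFactorR]
  exact prod_congr rfl fun k _ => (Real.exp_log (h.stepFactorR_pos' hγ1 k)).symm

/-- **`P_n → c`** (`c = prodFactorRLim = exp(Σ_k log F_k)`), massive case.
[cite: BauerschmidtBrydgesSlade2015Flow, Lemma 2.1(iii)(a) (c_j = lim_l c_{j,l})] -/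
theorem tendsto_prodFactorR (hγ0 : 0 ≤ γ) (hγ1 : γ ≤ 1) (hρ : Summable ρ) :
    Tendsto (prodFactorR β g γ) atTop (𝓝 (prodFactorRLim β g γ)) := by
  have hs := h.summable_log_stepFactorR hγ0 hγ1 hρ
  have := (Real.continuous_exp.tendsto _).comp hs.tendsto_sum_tsum_nat
  refine this.congr fun n => ?_
  simp only [Function.comp_apply]
  exact (h.prodFactorR_eq_exp_sum hγ1 n).symm

omit h in
/-- `c > 0`. [folklore] -/
theorem prodFactorRLim_pos : 0 < prodFactorRLim β g γ := Real.exp_pos _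

/-- **`c = 1 + O(g₀)`**, two-sided: `1 - (16/9)γBg₀(1 + 2Q) - (4/3)Q ≤ c ≤ exp((4/3)Q)`,
`Q = Σ_k ρ_kǧ_k` (in the source `Q = RΣ_kχ_kǧ_k² = O(g₀)`).
[cite: BauerschmidtBrydgesSlade2015Flow, Lemma 2.1(iii)(a) (c_j = 1 + O(χ_jḡ_j))]
[cite: BauerschmidtBrydgesSlade2015LogCorr, §8.3 (c_j = 1 + O(χ_jḡ_j))] -/
theorem prodFactorRLim_mem (hγ0 : 0 ≤ γ) (hγ1 : γ ≤ 1) (hρ : Summable ρ) :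
    prodFactorRLim β g γ ∈ Set.Icc
      (1 - 16 / 9 * γ * (B * g₀ * (1 + 2 * ∑' k, ρ k * g k)) - 4 / 3 * ∑' k, ρ k * g k)
      (Real.exp (4 / 3 * ∑' k, ρ k * g k)) := by
  have hT := h.tendsto_prodFactorR hγ0 hγ1 hρ
  have hρg : Summable fun k => ρ k * g k :=
    Summable.of_nonneg_of_le (fun k => mul_nonneg (h.rho_nonneg k) (h.g_pos k).le)
      (fun k => by
        calc ρ k * g k ≤ ρ k * 1 := mul_le_mul_of_nonneg_left (h.g_le_one k) (h.rho_nonneg k)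
          _ = ρ k := mul_one _) hρ
  have hQ : ∀ n, ∑ k ∈ range n, ρ k * g k ≤ ∑' k, ρ k * g k := fun n =>
    hρg.sum_le_tsum (range n) fun k _ => mul_nonneg (h.rho_nonneg k) (h.g_pos k).le
  have hBg : 0 ≤ B * g₀ := mul_nonneg h.B_nonneg h.pos₀.le
  constructor
  · refine ge_of_tendsto' hT fun n => le_trans ?_ (h.one_sub_le_prodFactorR hγ0 hγ1 n)
    have h1 : 16 / 9 * γ * (B * g₀ * (1 + 2 * ∑ k ∈ range n, ρ k * g k)) ≤
        16 / 9 * γ * (B * g₀ * (1 + 2 * ∑' k, ρ k * g k)) :=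
      mul_le_mul_of_nonneg_left (mul_le_mul_of_nonneg_left (by linarith [hQ n]) hBg)
        (by positivity)
    linarith [hQ n]
  · refine le_of_tendsto' hT fun n => (h.prodFactorR_le_exp hγ0 hγ1 n).trans ?_
    exact Real.exp_le_exp.2 (mul_le_mul_of_nonneg_left (hQ n) (by norm_num))

/-- **The tail estimate "`c_{j,l} = c_j + O(χ_lḡ_l)`"**: `P_n e^{-T_n} ≤ c ≤ P_n e^{T_n}` with
`T_n = Σ_{k≥n}((32/9)γt_k² + 4|s_k|)` (`→ 0`), since `c/P_n = exp(Σ_{k≥n} log F_k)` and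
`|log F_k| ≤ (32/9)γt_k² + 4|s_k|`.
[cite: BauerschmidtBrydgesSlade2015Flow, Lemma 2.1(iii)(a) (c_j - c_{j,l} = c_j(1 - exp(-Σ_{k≥l} log(1 + r_k))))] -/
theorem prodFactorRLim_mem_mul_exp (hγ0 : 0 ≤ γ) (hγ1 : γ ≤ 1) (hρ : Summable ρ) (n : ℕ) :
    prodFactorRLim β g γ ∈ Set.Icc
      (prodFactorR β g γ n *
        Real.exp (-∑' k, (32 / 9 * γ * (β (k + n) * g (k + n)) ^ 2 + 4 * |flowRem β g (k + n) / g (k + n)|)))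
      (prodFactorR β g γ n *
        Real.exp (∑' k, (32 / 9 * γ * (β (k + n) * g (k + n)) ^ 2 + 4 * |flowRem β g (k + n) / g (k + n)|))) := by
  set F : ℕ → ℝ := fun k => stepFactorR γ (β k * g k) (flowRem β g k / g k) with hF
  set w : ℕ → ℝ := fun k => 32 / 9 * γ * (β k * g k) ^ 2 + 4 * |flowRem β g k / g k| with hw
  have hs := h.summable_log_stepFactorR hγ0 hγ1 hρ
  have hws := h.summable_majorant (γ := γ) hρ
  have hsn : Summable fun k => Real.log (F (k + n)) := (summable_nat_add_iff n).2 hs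
  have hwn : Summable fun k => w (k + n) := (summable_nat_add_iff n).2 hws
  -- c = P_n · exp(Σ_{k≥n} log F_k)
  have hsplit : prodFactorRLim β g γ = prodFactorR β g γ n * Real.exp (∑' k, Real.log (F (k + n))) := by
    rw [prodFactorRLim, h.prodFactorR_eq_exp_sum hγ1 n, ← Real.exp_add]
    congr 1
    exact (hs.sum_add_tsum_nat_add n).symm
  have hbd : ∀ k, |Real.log (F (k + n))| ≤ w (k + n) := fun k =>
    h.abs_log_stepFactorR_le hγ0 hγ1 (k + n)
  have hup : ∑' k, Real.log (F (k + n)) ≤ ∑' k, w (k + n) :=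
    hsn.tsum_le_tsum (fun k => (le_abs_self _).trans (hbd k)) hwn
  have hlo : -∑' k, w (k + n) ≤ ∑' k, Real.log (F (k + n)) := by
    rw [← tsum_neg]
    exact hwn.neg.tsum_le_tsum (fun k => (neg_le_neg (hbd k)).trans (neg_abs_le _)) hsn
  have hP := (h.prodFactorR_pos hγ1 n).le
  rw [hsplit]
  exact ⟨mul_le_mul_of_nonneg_left (Real.exp_le_exp.2 hlo) hP,
    mul_le_mul_of_nonneg_left (Real.exp_le_exp.2 hup) hP⟩

omit h in
/-- The tail `T_n → 0`. [folklore] -/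
theorem tendsto_tail_majorant :
    Tendsto (fun n => ∑' k, (32 / 9 * γ * (β (k + n) * g (k + n)) ^ 2 +
      4 * |flowRem β g (k + n) / g (k + n)|)) atTop (𝓝 0) :=
  tendsto_sum_nat_add fun k => 32 / 9 * γ * (β k * g k) ^ 2 + 4 * |flowRem β g k / g k|

/-- **The product formula in the printed shape, with remainder** (`j = 0`, `0 ≤ γ ≤ 1`, massive
case): `(g₀/ǧ_n)^γ c e^{-T_n} ≤ ∏_{k<n}(1 - γβ_kǧ_k)⁻¹ ≤ (g₀/ǧ_n)^γ c e^{T_n}`, `T_n → 0`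
(`tendsto_tail_majorant`), `c = 1 + O(g₀)` (`prodFactorRLim_mem`):
"`∏_{k=j}^l(1 - γβ_kǧ_k)⁻¹ = (ǧ_j/ǧ_{l+1})^γ(c_j + O(χ_lḡ_l))`, `c_j = 1 + O(χ_jḡ_j)`".
[cite: BauerschmidtBrydgesSlade2015LogCorr, §8.3 (the product formula before the third lemma; Π_j in its proof)]
[cite: BauerschmidtBrydgesSlade2015Flow, Lemma 2.1(iii)(a)] -/
theorem prod_inv_one_sub_mem (hγ0 : 0 ≤ γ) (hγ1 : γ ≤ 1) (hρ : Summable ρ) (n : ℕ) :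
    ∏ k ∈ range n, (1 - γ * (β k * g k))⁻¹ ∈ Set.Icc
      ((g₀ / g n) ^ γ * prodFactorRLim β g γ *
        Real.exp (-∑' k, (32 / 9 * γ * (β (k + n) * g (k + n)) ^ 2 + 4 * |flowRem β g (k + n) / g (k + n)|)))
      ((g₀ / g n) ^ γ * prodFactorRLim β g γ *
        Real.exp (∑' k, (32 / 9 * γ * (β (k + n) * g (k + n)) ^ 2 + 4 * |flowRem β g (k + n) / g (k + n)|))) := by
  rw [h.prod_inv_one_sub_eq hγ1 n]
  have hR : 0 ≤ (g₀ / g n) ^ γ := Real.rpow_nonneg (div_pos h.pos₀ (h.g_pos n)).le _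
  obtain ⟨hlo, hup⟩ := h.prodFactorRLim_mem_mul_exp hγ0 hγ1 hρ n
  set T := ∑' k, (32 / 9 * γ * (β (k + n) * g (k + n)) ^ 2 + 4 * |flowRem β g (k + n) / g (k + n)|)
  set c := prodFactorRLim β g γ
  set P := prodFactorR β g γ n
  -- from P e^{-T} ≤ c ≤ P e^{T}: c e^{-T} ≤ P ≤ c e^{T}
  have h1 : c * Real.exp (-T) ≤ P := by
    have := mul_le_mul_of_nonneg_right hup (Real.exp_pos (-T)).le
    rwa [mul_assoc, ← Real.exp_add, add_neg_cancel, Real.exp_zero, mul_one] at this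
  have h2 : P ≤ c * Real.exp T := by
    have := mul_le_mul_of_nonneg_right hlo (Real.exp_pos T).le
    rwa [mul_assoc, ← Real.exp_add, neg_add_cancel, Real.exp_zero, mul_one] at this
  constructor
  · rw [mul_assoc]; exact mul_le_mul_of_nonneg_left h1 hR
  · rw [mul_assoc]; exact mul_le_mul_of_nonneg_left h2 hR

end GchHyp

end CTWSAW

end Literature.Barriers.CriticalPhenomena
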